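import Literature.Combinatorics.SimpleGraph.TreeRetractionOntoSubtree   -- ★ `TreeRetraction.exists_retraction` (height ∕ parent toward a subtree, equivariance)
import Literature.Combinatorics.SimpleGraph.TreeAutomorphismFixedPoints  -- ★ `BakerNorine.connected_induce_fixed` (the fixed set of a tree automorphism is a subtree)
import HarnessLib

/-!
# The displacement of an elliptic automorphism of a tree: `d(v, αv) = 2·d(v, Fix α)` (Serre, *Trees* I.6.4; Tits)

Topic `Combinatorics/SimpleGraph`; namespace `Literature.Combinatorics.SimpleGraph.TreeDisplacement`.  THEOREMS ONLY (no definition, no instance, no notation, no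
named fact, no `sorry`); Mathlib + the two ★ tree files above; arbitrary vertex type.  Cell `pub/hodgecm-mathlib`, F0∕P3a, crux H413 = `stmt-HodgeConjecture-24833`, line
«N6nsGerm», residue `stub_N6nsS3id` (transfer at the identity), road «S3-tree» (census «S3» v2 §4 (R-T)): architect A-p16 (g28), WORD S3-W2 (2026-09-01): «structural
reason = the TREE LEMMA `d(L, γL) = 2·d(L, Fix γ)` ⇒ `O(γ, 1_{Kt^kK}) ∝ C_k(γ) = #{type-0 L : d(L, Fix γ) = k}` (sphere counts around the fixed subtree) … T2 fixed subtree +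
SPHERE COUNTS `C_k(γ)` (the tree lemma above = the design core)».  Written by F0P3a-p08 (g17) as a GENERIC organ (pure graph theory; the consumer is the Bruhat–Tits tree
of `U(2,1)(F_v)` with `γ` a deep elliptic element of `H_v`).  HONEST LABEL: HC_CM is proved only modulo the printed citations (the 2 remaining named inputs hLiu418, h413)
until rung 0 closes; this file asserts nothing printed about unitary groups.

THE MATHEMATICS ([Serre1980Trees] I.6.4 Prop. 24–25, elliptic case; Tits' lemma).  Let `G` be a tree, `α : G ≃g G` an automorphism WITH A FIXED VERTEX, `Y = Fix α = {u | α u = u}`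
(a subtree, ★ `connected_induce_fixed`), and `h(v) = dist(v, Y)` the height above `Y` with its parent map `p` (★ `exists_retraction`; `h ∘ α = h` because `α(Y) = Y`).
Then for every vertex `v`:  **`dist(v, αv) = 2·h(v)`**.  PROOF by induction on `h v`: if `h v = 0` then `v ∈ Y`, `αv = v`; if `h v = n + 1` then `u = p v` has `h u = n`, the
inductive path `u ⇝ αu` has length `2n` and all its vertices at height `≤ n`, so `v — u ⇝ αu — αv` is a PATH of length `2n + 2` (its two new ends have height `n + 1`, and
`v ≠ αv` since `v ∉ Y`); in a tree a path is the geodesic (Mathlib `IsTree.existsUnique_path`, `Connected.exists_path_of_dist`).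

* §1 `exists_path_two_mul` — the inductive construction (for any height∕parent data with the three properties used).
* §2 **`exists_height`** — the packaged statement: `∃ h`, `h v` is the distance from `v` to `Fix α` (attained and minimal) and `∀ v, G.dist v (α v) = 2 * h v`;
  **`dist_self_apply_eq_two_mul_dist`** — `h`-free: if `y` is a NEAREST fixed vertex to `v` then `G.dist v (α v) = 2 * G.dist v y`;
  `even_dist_self_apply` — the displacement is EVEN; `not_adj_self_apply` — an automorphism with a fixed vertex moves no vertex to a neighbour;
  `dist_self_apply_eq_zero_iff` — `G.dist v (α v) = 0 ↔ α v = v` (trivial, recorded for the shell dictionary);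
  **`setOf_dist_self_apply_eq`** — THE SPHERE DICTIONARY: `{v | G.dist v (α v) = 2 * k} = {v | h v = k}` and `{v | G.dist v (α v) = 2 * k + 1} = ∅` — the vertices
  displaced by `2k` are exactly the vertices at distance `k` from the fixed subtree (the `C_k(γ)` of WORD S3-W2).

## References
* [Serre1980Trees] J.-P. Serre, *Trees*, Springer (1980): I.2.2 Prop. 8 (unique geodesics), I.2.3 (projection onto a subtree), I.6.4 Prop. 24–25 (automorphisms of trees:
  fixed points vs. axis; `d(v, αv) = 2·d(v, X_α) + ℓ(α)`).
* [Meier2008] J. Meier, *Groups, Graphs and Trees*, CUP (2008), Lemma 3.50 (`Fix` is a subtree).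
* [Diestel2010] R. Diestel, *Graph Theory*, 4th ed., Thm. 1.5.1 (unique paths in trees).
-/

set_option autoImplicit false

open SimpleGraph

namespace Literature.Combinatorics.SimpleGraph.TreeDisplacement

variable {V : Type*} {G : SimpleGraph V}

/-! ## §1 The inductive path `v — p v ⇝ α(p v) — αv` -/

/-- **The descent–ascent path.**  Given height∕parent data toward the fixed set of `α` — `h v = 0 ↔ α v = v`, a parent step `v ~ p v`, `h (p v) + 1 = h v` off the fixed set,
and `α`-invariance `h (α v) = h v` — every vertex `v` is joined to `α v` by a PATH of length `2·h v` all of whose vertices have height `≤ h v`.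
[cite: Serre1980Trees, I.6.4 Prop. 24] -/
theorem exists_path_two_mul (α : G ≃g G) (h : V → ℕ) (p : V → V) (h0 : ∀ v, h v = 0 ↔ α v = v)
    (hp : ∀ v, α v ≠ v → G.Adj v (p v) ∧ h (p v) + 1 = h v) (hα : ∀ v, h (α v) = h v) :
    ∀ (n : ℕ) (v : V), h v = n → ∃ W : G.Walk v (α v), W.IsPath ∧ W.length = 2 * n ∧ ∀ x ∈ W.support, h x ≤ n := by
  intro n
  induction n with
  | zero =>
    intro v hv
    have hfix : α v = v := (h0 v).1 hv
    refine ⟨(Walk.nil : G.Walk v v).copy rfl hfix.symm, ?_, ?_, ?_⟩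
    · rw [Walk.isPath_copy]; exact Walk.IsPath.nil
    · rw [Walk.length_copy, Walk.length_nil]
    · intro x hx
      rw [Walk.support_copy, Walk.support_nil, List.mem_singleton] at hx
      rw [hx, hv]
  | succ n ih =>
    intro v hv
    have hvY : α v ≠ v := fun hfix => by
      have := (h0 v).2 hfix
      omega
    obtain ⟨hadj, hpu⟩ := hp v hvY
    have hu : h (p v) = n := by omega
    obtain ⟨W, hWp, hWl, hWs⟩ := ih (p v) hu
    -- the new ends are not on `W` (their height is `n + 1`)
    have hv_notin : v ∉ W.support := fun hx => by have := hWs v hx; omega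
    have hαv_notin : α v ∉ W.support := fun hx => by have := hWs (α v) hx; rw [hα] at this; omega
    have hadj' : G.Adj (α (p v)) (α v) := (α.map_adj_iff).2 hadj.symm
    -- `W.concat : p v ⇝ α v`, then `cons : v ⇝ α v`
    have hcat : (W.concat hadj').IsPath := hWp.concat hαv_notin hadj'
    refine ⟨Walk.cons hadj (W.concat hadj'), ?_, ?_, ?_⟩
    · rw [Walk.cons_isPath_iff]
      refine ⟨hcat, ?_⟩
      rw [Walk.support_concat, List.mem_append, List.mem_singleton, not_or]
      exact ⟨hv_notin, fun heq => hvY heq.symm⟩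
    · rw [Walk.length_cons, Walk.length_concat, hWl]
      ring
    · intro x hx
      rw [Walk.support_cons, List.mem_cons, Walk.support_concat, List.mem_append, List.mem_singleton] at hx
      rcases hx with rfl | hx | rfl
      · omega
      · exact (hWs x hx).trans (Nat.le_succ n)
      · rw [hα]; omega

/-- In a tree, a path realises the distance. [cite: Diestel2010, Thm. 1.5.1] -/
theorem dist_eq_length_of_isPath (hT : G.IsTree) {v w : V} {W : G.Walk v w} (hW : W.IsPath) : G.dist v w = W.length := by
  obtain ⟨Q, hQ, hQl⟩ := hT.1.exists_path_of_dist v w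
  have hQW : Q = W := (hT.existsUnique_path v w).unique hQ hW
  rw [← hQl, hQW]

/-! ## §2 `dist(v, αv) = 2·dist(v, Fix α)` -/

/-- **THE DISPLACEMENT OF AN ELLIPTIC AUTOMORPHISM OF A TREE** ([Serre1980Trees] I.6.4): for a tree `G` and `α : G ≃g G` fixing some vertex there is a height function `h`
with `h v` = the distance from `v` to the fixed set `{y | α y = y}` (attained at some fixed `y`, and minimal), `h v = 0 ↔ α v = v`, `h (α v) = h v`, and
**`G.dist v (α v) = 2 * h v` for every vertex `v`**.  (Heights∕parents from ★ `TreeRetraction.exists_retraction` applied to the fixed subtree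
★ `BakerNorine.connected_induce_fixed`; the path of §1 is the geodesic by uniqueness of paths in a tree.) [cite: Serre1980Trees, I.6.4 Prop. 24] [cite: Meier2008, Lemma 3.50] -/
theorem exists_height (hT : G.IsTree) (α : G ≃g G) {u : V} (hu : α u = u) :
    ∃ h : V → ℕ, (∀ v, (∃ y, α y = y ∧ G.dist v y = h v) ∧ ∀ y, α y = y → h v ≤ G.dist v y) ∧ (∀ v, h v = 0 ↔ α v = v) ∧ (∀ v, h (α v) = h v) ∧
      ∀ v, G.dist v (α v) = 2 * h v := by
  have hYne : ({y | α y = y} : Set V).Nonempty := ⟨u, hu⟩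
  have hYc : (G.induce {y | α y = y}).Connected := BakerNorine.connected_induce_fixed hT α hu
  obtain ⟨h, p, hdist, h0, hpar, -, -, hequi⟩ := TreeRetraction.exists_retraction hT hYne hYc
  have hαY : ∀ v, α v ∈ ({y | α y = y} : Set V) ↔ v ∈ ({y | α y = y} : Set V) := fun v => by
    simp only [Set.mem_setOf_eq]
    exact α.injective.eq_iff
  have hα : ∀ v, h (α v) = h v := fun v => (hequi α hαY v).1
  refine ⟨h, fun v => ⟨?_, fun y hy => (hdist v).2 y hy⟩, h0, hα, fun v => ?_⟩
  · obtain ⟨y, hy, hd⟩ := (hdist v).1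
    exact ⟨y, hy, hd⟩
  · obtain ⟨W, hW, hWl, -⟩ := exists_path_two_mul α h p h0 (fun v hv => hpar v hv) hα (h v) v rfl
    rw [dist_eq_length_of_isPath hT hW, hWl]

/-- **`d(v, αv) = 2·d(v, y)` FOR A NEAREST FIXED VERTEX `y`** (height-free form): if `α y = y` and `G.dist v y ≤ G.dist v y′` for every fixed `y′`, then
`G.dist v (α v) = 2 * G.dist v y`. [cite: Serre1980Trees, I.6.4 Prop. 24] -/
theorem dist_self_apply_eq_two_mul_dist (hT : G.IsTree) (α : G ≃g G) {v y : V} (hy : α y = y) (hmin : ∀ y', α y' = y' → G.dist v y ≤ G.dist v y') :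
    G.dist v (α v) = 2 * G.dist v y := by
  obtain ⟨h, hdist, -, -, hmain⟩ := exists_height hT α hy
  obtain ⟨⟨y₀, hy₀, hd₀⟩, hle⟩ := hdist v
  have heq : h v = G.dist v y := le_antisymm (hle y hy) (hd₀ ▸ hmin y₀ hy₀)
  rw [hmain, heq]

/-- **The displacement of an automorphism with a fixed vertex is EVEN.** [cite: Serre1980Trees, I.6.4 Prop. 24] -/
theorem even_dist_self_apply (hT : G.IsTree) (α : G ≃g G) {u : V} (hu : α u = u) (v : V) : Even (G.dist v (α v)) := by
  obtain ⟨h, -, -, -, hmain⟩ := exists_height hT α hu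
  exact ⟨h v, by rw [hmain, two_mul]⟩

/-- **An automorphism of a tree with a fixed vertex moves no vertex to a neighbour** (`dist = 1` is odd). [cite: Serre1980Trees, I.6.4 Prop. 24] -/
theorem not_adj_self_apply (hT : G.IsTree) (α : G ≃g G) {u : V} (hu : α u = u) (v : V) : ¬ G.Adj v (α v) := by
  intro hadj
  have h1 : G.dist v (α v) = 1 := dist_eq_one_iff_adj.2 hadj
  obtain ⟨k, hk⟩ := even_dist_self_apply hT α hu v
  omega

/-- `G.dist v (α v) = 0 ↔ α v = v` (a tree is connected). [cite: Serre1980Trees, I.6.4 Prop. 24] -/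
theorem dist_self_apply_eq_zero_iff (hT : G.IsTree) (α : G ≃g G) (v : V) : G.dist v (α v) = 0 ↔ α v = v := by
  rw [hT.1.dist_eq_zero_iff, eq_comm]

/-- **THE SPHERE DICTIONARY** (the `C_k(γ)` of road «S3-tree»): with `h` as in `exists_height` (the distance to the fixed subtree), for every `k` the vertices DISPLACED BY `2k`
are exactly the vertices AT DISTANCE `k` FROM `Fix α`, and no vertex is displaced by an odd amount:
`{v | G.dist v (α v) = 2k} = {v | h v = k}`, `{v | G.dist v (α v) = 2k + 1} = ∅`. [cite: Serre1980Trees, I.6.4 Prop. 24] -/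
theorem setOf_dist_self_apply_eq (hT : G.IsTree) (α : G ≃g G) {u : V} (hu : α u = u) :
    ∃ h : V → ℕ, (∀ v, (∃ y, α y = y ∧ G.dist v y = h v) ∧ ∀ y, α y = y → h v ≤ G.dist v y) ∧
      (∀ k : ℕ, {v | G.dist v (α v) = 2 * k} = {v | h v = k}) ∧ ∀ k : ℕ, {v | G.dist v (α v) = 2 * k + 1} = ∅ := by
  obtain ⟨h, hdist, -, -, hmain⟩ := exists_height hT α hu
  refine ⟨h, hdist, fun k => ?_, fun k => ?_⟩
  · ext v
    simp only [Set.mem_setOf_eq, hmain]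
    omega
  · ext v
    simp only [Set.mem_setOf_eq, hmain, Set.mem_empty_iff_false, iff_false]
    omega

end Literature.Combinatorics.SimpleGraph.TreeDisplacement
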